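import Literature.Probability.Percolation.ArmSeparationOutExt
import Literature.Probability.Percolation.ArmSeparationExtFourArmQ
import Literature.Probability.Percolation.LocallyMonotoneFKG
import HarnessLib

/-!
# Outward extension of four landed arms of alternating colours, at constant cost, at `p`

Topic `Literature/Probability/Percolation`; family `crit-perc` / near-critical percolation on `𝕋`.
A brick of the near-critical arm-separation theorem for four arms of alternating colours
(P. Nolin, *Near-critical percolation in two dimensions*, EJP 13 (2008), Thm. 11 for `j = 4`,
`σ = BWBW` [arXiv 0711.4948: Thm. 10]; §4.4 p. 12, the constant `C₀`; Prop. 12 (i)): the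
constant-cost extension step `h K ≤ C₀ · h (K+1)` of the multi-scale scheme for the four arms landed
on the sides `0, 2, 3, 5` of the outer boundary, `extFourArmQ n R` (`ArmSeparationExtFourArmQ`), at
a general parameter `p` with Russo–Seymour–Welsh inputs at `p` and `1 - p` (below the
characteristic length this is how the near-critical theory uses it):

  `P_p(extFourArmQ n R) · (c^95)⁴ ≤ P_p(extFourArmQ n R')`  for `2200 ≤ R`, `2n ≤ R`, `2R ≤ R' ≤ 32R`.

The two-arm corridor of `ArmSeparationOutExt` fills the quarter-region `{x₀ > R, -R'/2 ≤ x₁ ≤ 0}`;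
four such corridors on the sides `0, 2, 3, 5` would overlap near the corners `(N, -N)` and
`(-N, N)`. Here the corridor is bent so as to stay in the open cone `{x₁ ≤ 0 < x₀ + x₁}` of the
side `0` (`sepOutCorrQ`): the comb boxes and a short highway next to the old free spaces, a long
horizontal box at the level of the old landing row out to the column `R'`, a vertical box down the
inner side of the column `R'` to the row `-R'/2`, a short horizontal box across `∂Λ_{R'}`, and the
vertical crossing of the thinned target free space at the landing site `(R', -R'/2)`; the cones of
the four sides are pairwise disjoint, and the landed-arm events themselves only depend, beyond
`Λ_R`, on sites of their cones (`extConeSet`, `determinedBy_extOpenArm_cone`). Then: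

* `extOpenArm_inter_sepOutCorrQ_subset` — deterministic gluing (relay lemma);
* `le_real_sepOutCorrQ_at` — `P_q(sepOutCorrQ R R') ≥ c^95` from RSW at `q` for boxes of height `≤ R'`;
* `real_extFourArmQ_mul_le_outward_at` — the extension inequality, by Nolin's Lemma 13 for locally
  monotone events (`triSitePercolation_locallyMonotone_fkg`) with the shared shell
  `{n ≤ |v| ≤ R}`, the increasing region (cones of the sides `0`, `3` beyond `Λ_R`) and the
  decreasing region (cones of the sides `2`, `5`), Harris at `p` and at `1 - p`.

Everything here is proved; no named facts are introduced.

## References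

* P. Nolin, Near-critical percolation in two dimensions, *Electron. J. Probab.* 13 (2008), §4.3
  Prop. 12 (i) and Lemma 13, §4.4 (arXiv 0711.4948: Prop. 11, Lemma 12; proof of Thm. 10, p. 12) [Nolin2008].
* H. Kesten, Scaling relations for 2D-percolation, *Comm. Math. Phys.* 109 (1987), Lemma 2 [Kesten1987].

Tree: `extOpenArm`, `extFourArmQ`, `sepOutComb`, `exists_sepInComb_rows`, `PathIn.relay`,
`exists_mem_of_cross`, `triSitePercolation_locallyMonotone_fkg`, `sitePercolation_harris`,
`real_preimage_frameConfig`, `sitePercolation_real_preimage_compl`.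
-/

noncomputable section

open MeasureTheory Set

namespace Literature.Probability.Percolation

open LatticeModels

/-! ### The cone support of a landed arm -/

/-- **The cone support of the outer-landed arm event**: the shell `{n ≤ |v| ≤ N + N/8}`, the sites
beyond `Λ_N` lying in the open cone `{x₁ < 0 < x₀ + x₁}` of the right side. [cite: Nolin2008, §4.2 Def. 6 (arXiv 0711.4948)] -/
def extConeSet (n N : ℕ) : Set (Site 2) :=
  {v | (n : ℤ) ≤ triNorm v ∧ triNorm v ≤ (N : ℤ) + (N / 8 : ℕ) ∧ ((N : ℤ) < triNorm v → v 1 < 0 ∧ 0 < v 0 + v 1)}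

/-- Membership in `extConeSet`, unfolded. [folklore] -/
@[simp] theorem mem_extConeSet {n N : ℕ} {v : Site 2} :
    v ∈ extConeSet n N ↔ (n : ℤ) ≤ triNorm v ∧ triNorm v ≤ (N : ℤ) + (N / 8 : ℕ) ∧ ((N : ℤ) < triNorm v → v 1 < 0 ∧ 0 < v 0 + v 1) :=
  Iff.rfl

section Cone

variable {n N : ℕ}

/-- The outer free space lies in the cone support (`n ≤ N`). [cite: Nolin2008, §4.2 Def. 6 (arXiv 0711.4948)] -/
theorem sepOuterFence_subset_extConeSet (hnN : n ≤ N) {z : Site 2} (hz : z ∈ sepLanding N) :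
    sepOuterFence N z ⊆ extConeSet n N := by
  intro v hv
  have h := sepOuterFence_subset_extSupportSet hnN hz hv
  rw [mem_extSupportSet] at h
  rw [mem_sepOuterFence] at hv
  rw [mem_sepLanding] at hz
  exact ⟨h.1, h.2.1, fun _ => ⟨by omega, by omega⟩⟩

/-- The arm region lies in the cone support (`2n ≤ N`). [cite: Nolin2008, §4.2 Def. 6 (arXiv 0711.4948)] -/
theorem extRegion_subset_extConeSet (hnN : 2 * n ≤ N) {z : Site 2} (hz : z ∈ sepLanding N) :
    triAnnulusSet n N ∪ triOpenBall z (N / 8) ⊆ extConeSet n N := by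
  intro v hv
  have h := extRegion_subset_extSupportSet hnN hz hv
  rw [mem_extSupportSet] at h
  rw [mem_sepLanding] at hz
  refine ⟨h.1, h.2.1, fun hN' => ?_⟩
  rcases hv with hv | hv
  · rw [mem_triAnnulusSet] at hv; omega
  · rw [mem_triOpenBall, triNorm_lt_iff_lin] at hv
    simp only [Pi.sub_apply] at hv
    constructor <;> omega

/-- The event only depends on the sites of its cone support (`2n ≤ N`). [folklore] -/
theorem mem_extOpenArm_iff_inter_cone (hnN : 2 * n ≤ N) (ω : SiteConfig (Site 2)) :
    ω ∈ extOpenArm n N ↔ ω ∩ extConeSet n N ∈ extOpenArm n N := by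
  constructor
  · rintro ⟨z, u', a, hz, ha, ⟨b, t, hb, ht, p₁, p₂⟩, p⟩
    have hO := sepOuterFence_subset_extConeSet (n := n) (by omega) hz
    have hR := extRegion_subset_extConeSet hnN hz
    exact ⟨z, u', a, hz, ha, ⟨b, t, hb, ht, (pathIn_inter_inter_of_subset hO).2 p₁, (pathIn_inter_inter_of_subset hO).2 p₂⟩,
      (pathIn_inter_inter_of_subset hR).2 p⟩
  · intro h
    exact isUpperSet_extOpenArm n N (show ω ∩ extConeSet n N ≤ ω from inter_subset_left) h

/-- **Locality of the outer-landed arm in its cone**: `extOpenArm n N` is determined by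
`extConeSet n N` (`2n ≤ N`). [folklore] -/
theorem determinedBy_extOpenArm_cone (hnN : 2 * n ≤ N) : DeterminedBy (extOpenArm n N) (extConeSet n N) := by
  rw [determinedBy_iff]
  intro ω ω' hω
  rw [mem_extOpenArm_iff_inter_cone hnN ω, mem_extOpenArm_iff_inter_cone hnN ω', hω]

end Cone

/-! ### The bent corridor -/

/-- **The bent outward corridor** from the outer free spaces at scale `R` to the outer free space at
the landing site `(R', -R'/2)` of scale `R'`, inside the cone of the right side: (i) the vertical
crossing of the thinned target free space `[R'+1, R'+R'/16] × [-R'/2 - R'/64, -R'/2 + R'/64]`;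
(ii) a horizontal crossing of `[R'-R'/16, R'+R'/16] × [-R'/2, -R'/2 + R'/64]`; (iii) a vertical
crossing of `[R'-R'/16, R'-1] × [-R'/2, -R/2 + R'/64]`; (iv) a horizontal crossing of
`[R+R/8+1, R'] × [-R/2, -R/2 + R'/64]`; (v) a vertical crossing of the highway
`[R+R/8+1, R+2(R/8)+1] × [-G, 0]`, `G = sepGlueHeight R`; (vi) the `90` comb boxes. [cite: Nolin2008, §4.3 Prop. 12 (i) (proof) (arXiv 0711.4948: Prop. 11); §4.4 p. 12 (constant C₀)] -/
def sepOutCorrQ (R R' : ℕ) : Set (SiteConfig (Site 2)) :=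
  triVCross ((R' : ℤ) + 1) (-((R' / 2 : ℕ) : ℤ) - (R' / 64 : ℕ)) (R' / 16 - 1) (2 * (R' / 64)) ∩
    triHCross ((R' : ℤ) - (R' / 16 : ℕ)) (-((R' / 2 : ℕ) : ℤ)) (2 * (R' / 16)) (R' / 64) ∩
    triVCross ((R' : ℤ) - (R' / 16 : ℕ)) (-((R' / 2 : ℕ) : ℤ)) (R' / 16 - 1) (R' / 2 - R / 2 + R' / 64) ∩
    triHCross ((R : ℤ) + (R / 8 : ℕ) + 1) (-((R / 2 : ℕ) : ℤ)) (R' - (R + R / 8 + 1)) (R' / 64) ∩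
    triVCross ((R : ℤ) + (R / 8 : ℕ) + 1) (-(sepGlueHeight R : ℤ)) (R / 8) (sepGlueHeight R) ∩
    ⋂ i ∈ Finset.range 90, sepOutComb R i

/-- `sepOutCorrQ` is increasing. [folklore] -/
theorem isUpperSet_sepOutCorrQ (R R' : ℕ) : IsUpperSet (sepOutCorrQ R R') := by
  refine (((((isUpperSet_triVCross _ _ _ _).inter (isUpperSet_triHCross _ _ _ _)).inter
    (isUpperSet_triVCross _ _ _ _)).inter (isUpperSet_triHCross _ _ _ _)).inter (isUpperSet_triVCross _ _ _ _)).inter ?_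
  exact isUpperSet_iInter₂ fun i _ => isUpperSet_triHCross _ _ _ _

section Regions

variable {n R R' : ℕ}

/-- The glue height. [folklore] -/
theorem sepGlueHeight_cast (R : ℕ) : (sepGlueHeight R : ℤ) = (R : ℤ) - (R / 4 : ℕ) + (R / 64 : ℕ) := by
  unfold sepGlueHeight; omega

/-- A box of columns `[n, R']` to the right of `Λ_n` with rows in `[-R', 0]` and `x₀ + x₁ ≥ 0`
lies in the annulus `{n ≤ |v| ≤ R'}`. [folklore] -/
theorem mem_triAnnulusSet_of_box {v : Site 2} (h0 : (n : ℤ) ≤ v 0) (h0' : v 0 ≤ (R' : ℤ)) (h1 : -(R' : ℤ) ≤ v 1) (h1' : v 1 ≤ 0)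
    (h2 : 0 ≤ v 0 + v 1) : v ∈ triAnnulusSet n R' := by
  refine ⟨le_triNorm_iff_lin.2 (Or.inl h0), triNorm_le_iff_lin.2 ?_⟩
  omega

end Regions

/-! ### The deterministic gluing -/

/-- **Outward extension of a landed arm along the bent corridor**:
`extOpenArm n R ∩ sepOutCorrQ R R' ⊆ extOpenArm n R'` for `2200 ≤ R`, `2n ≤ R`, `2R ≤ R' ≤ 32R`. The
comb box inside the old free space meets its vertical crossing; the highway meets the comb box and
the long horizontal box; that box meets the vertical box along the column `R'`, which meets the short
horizontal box across `∂Λ_{R'}`, which meets the vertical crossing of the thinned target free space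
at the new attaching site (`PathIn.relay`, `exists_mem_of_cross`); all pieces lie in the new arm
region `{n ≤ |v| ≤ R'} ∪ S̊_{R'/8}(z'')`. [cite: Nolin2008, §4.3 Prop. 12 (i) (proof) (arXiv 0711.4948: Prop. 11); §4.4 p. 12 (constant C₀)] -/
theorem extOpenArm_inter_sepOutCorrQ_subset {n R R' : ℕ} (hR : 2200 ≤ R) (hnR : 2 * n ≤ R) (hRR' : 2 * R ≤ R') (hR'R : R' ≤ 32 * R) :
    extOpenArm n R ∩ sepOutCorrQ R R' ⊆ extOpenArm n R' := by
  rintro ω ⟨⟨z, u', a, hz, ha, ⟨b, t, hb, ht, Pa, Pb⟩, P⟩, ⟨⟨⟨⟨⟨hV0, hH2⟩, hD⟩, hB⟩, hVh⟩, hG⟩⟩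
  have hzL := hz
  rw [mem_sepLanding] at hzL
  obtain ⟨hz0, hz1, hz2⟩ := hzL
  set z'' : Site 2 := ![(R' : ℤ), -((R' / 2 : ℕ) : ℤ)] with hz''
  have hz''1 : z'' 1 = -((R' / 2 : ℕ) : ℤ) := site_mk_apply_one _ _
  obtain ⟨b₀, t₀, hb₀, ht₀, PV⟩ := hV0
  obtain ⟨a₂, e₂, ha₂, he₂, PH2⟩ := hH2
  obtain ⟨bd, td, hbd, htd, PD⟩ := hD
  obtain ⟨ab, eb, hab, heb, PB⟩ := hB
  obtain ⟨bv, tv, hbv, htv, PVh⟩ := hVh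
  obtain ⟨i, hi, hgi1, hgi2⟩ := exists_sepInComb_rows hR hz
  have hGi : ω ∈ sepOutComb R i := (Set.mem_iInter₂.1 hG) i (Finset.mem_range.2 hi)
  obtain ⟨g₀, g₁, hg₀, hg₁, PG⟩ := hGi
  have hH := sepGlueHeight_cast R
  simp only [Nat.cast_mul, Nat.cast_ofNat] at ht₀ he₂
  have hih : (0 : ℤ) ≤ (i : ℤ) * ((R / 64 / 2 : ℕ) : ℤ) := by positivity
  have hih' : (i : ℤ) * ((R / 64 / 2 : ℕ) : ℤ) ≤ 89 * ((R / 64 / 2 : ℕ) : ℤ) :=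
    mul_le_mul_of_nonneg_right (by exact_mod_cast Nat.le_of_lt_succ hi) (by positivity)
  have hRR : 2 * (R : ℤ) ≤ R' := by exact_mod_cast hRR'
  have hR'R' : (R' : ℤ) ≤ 32 * R := by exact_mod_cast hR'R
  have e16 : ((R' / 16 - 1 : ℕ) : ℤ) = (R' / 16 : ℕ) - 1 := by omega
  have eD : ((R' / 2 - R / 2 + R' / 64 : ℕ) : ℤ) = (R' / 2 : ℕ) - (R / 2 : ℕ) + (R' / 64 : ℕ) := by omega
  have eB : ((R' - (R + R / 8 + 1) : ℕ) : ℤ) = (R' : ℤ) - R - (R / 8 : ℕ) - 1 := by omega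
  rw [eD] at htd
  rw [eB] at heb
  -- junction with the target free space
  obtain ⟨SH, hSH, PH', TH⟩ := PH2.exists_support
  obtain ⟨SV, hSV, PV', TV⟩ := PV.exists_support
  obtain ⟨p₁, hp₁H, hp₁V⟩ := exists_mem_of_cross (L := (R' : ℤ) + 1) (R := (R' : ℤ) + (R' / 16 : ℕ))
    (B := -((R' / 2 : ℕ) : ℤ) - (R' / 64 : ℕ)) (T := -((R' / 2 : ℕ) : ℤ) + (R' / 64 : ℕ)) (by omega) (by omega)
    PH' (by omega) (by omega)
    (fun v hv _ _ => by have h := (hSH hv).1; rw [mem_triStrip] at h; omega)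
    PV' hb₀.le (by omega)
    (fun v hv _ _ => by
      have h := (hSV hv).1; rw [mem_triStrip, e16] at h
      omega)
  have hSVF : SV ⊆ sepOuterFence R' z'' ∩ ω := fun v hv => ⟨sepOutCorrFence_subset_sepOuterFence (by omega) (hSV hv).1, (hSV hv).2⟩
  have hFence : OpenVCrossThrough (sepOuterFence R' z'') (z'' 1 - (R' / 64 : ℕ)) (z'' 1 + (R' / 64 : ℕ)) ω p₁ :=
    ⟨b₀, t₀, by rw [hz''1, hb₀], by rw [hz''1, ht₀]; ring, (TV p₁ hp₁V).mono hSVF,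
      ((TV p₁ hp₁V).symm.trans (TV t₀ PV'.right_mem)).mono hSVF⟩
  -- the relays
  have Q1 : PathIn triGraph (triStrip ((R' : ℤ) - (R' / 16 : ℕ)) (-((R' / 2 : ℕ) : ℤ)) (2 * (R' / 16)) (R' / 64) ∩ ω) a₂ p₁ :=
    (TH p₁ hp₁H).mono hSH
  have QH := PathIn.relay (L := (R' : ℤ) - (R' / 16 : ℕ)) (R := (R' : ℤ) - 1) (B := -((R' / 2 : ℕ) : ℤ))
    (T := -((R' / 2 : ℕ) : ℤ) + (R' / 64 : ℕ)) (by omega) (by omega) PH2 (by omega) (by omega)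
    (fun v hv _ _ => by rw [mem_triStrip] at hv; omega) PD hbd.le (by omega)
    (fun v hv _ _ => by rw [mem_triStrip, e16] at hv; omega)
  have Q1b := PathIn.relay (L := (R' : ℤ) - (R' / 16 : ℕ)) (R := (R' : ℤ) - 1) (B := -((R / 2 : ℕ) : ℤ))
    (T := -((R / 2 : ℕ) : ℤ) + (R' / 64 : ℕ)) (by omega) (by omega) PB (by omega) (by omega)
    (fun v hv _ _ => by rw [mem_triStrip] at hv; omega) PD (by omega) (by omega)
    (fun v hv _ _ => by rw [mem_triStrip, e16] at hv; omega)
  have Q2 := PathIn.relay (L := (R : ℤ) + (R / 8 : ℕ) + 1) (R := (R : ℤ) + 1 + 2 * (R / 8 : ℕ))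
    (B := -(sepGlueHeight R : ℤ)) (T := 0) (by omega) (by omega) PB (by omega) (by omega)
    (fun v hv _ _ => by rw [mem_triStrip] at hv; omega) PVh hbv.le (by omega)
    (fun v hv _ _ => by rw [mem_triStrip] at hv; omega)
  have Q3 := PathIn.relay (L := (R : ℤ) + (R / 8 : ℕ) + 1) (R := (R : ℤ) + 1 + 2 * (R / 8 : ℕ))
    (B := -(sepGlueHeight R : ℤ)) (T := 0) (by omega) (by omega) PG (by omega) (by omega)
    (fun v hv _ _ => by rw [sepOutComb_strip_iff] at hv; omega) PVh hbv.le (by omega)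
    (fun v hv _ _ => by rw [mem_triStrip] at hv; omega)
  have Q4 := PathIn.relay (L := (R : ℤ) + 1) (R := (R : ℤ) + (R / 8 : ℕ)) (B := z 1 - (R / 64 : ℕ)) (T := z 1 + (R / 64 : ℕ))
    (by omega) (by omega) PG (by omega) (by omega)
    (fun v hv _ _ => by rw [sepOutComb_strip_iff] at hv; omega) (Pa.trans Pb) hb.le ht.ge
    (fun v hv _ _ => by rw [mem_sepOuterFence] at hv; omega)
  -- the regions
  have hstrip : triStrip ((R' : ℤ) - (R' / 16 : ℕ)) (-((R' / 2 : ℕ) : ℤ)) (2 * (R' / 16)) (R' / 64) ⊆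
      triStrip ((R : ℤ) + (R / 8 : ℕ) + 1) (-((R' / 2 : ℕ) : ℤ)) (R' + R' / 16 - (R + R / 8 + 1)) (R' / 64) := by
    intro v hv
    rw [mem_triStrip] at hv ⊢
    rw [cast_sepOutCorr_width (by omega) hRR']
    push_cast at hv
    omega
  have R1 : triStrip ((R' : ℤ) - (R' / 16 : ℕ)) (-((R' / 2 : ℕ) : ℤ)) (2 * (R' / 16)) (R' / 64) ⊆
      triAnnulusSet n R' ∪ triOpenBall z'' (R' / 8) :=
    hstrip.trans (sepOutCorrHBox_subset (n := n) (R := R) (R' := R') (by omega) (by omega) hRR')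
  have R4 := sepOuterFence_subset_triAnnulusSet (n := n) (R' := R') (by omega) hRR' hz
  have R5 := extRegion_subset_triAnnulusSet hnR hRR' hz
  have hnR' : (n : ℤ) ≤ R := by have : 2 * n ≤ R := hnR; exact_mod_cast (by omega : n ≤ R)
  have RD : triStrip ((R' : ℤ) - (R' / 16 : ℕ)) (-((R' / 2 : ℕ) : ℤ)) (R' / 16 - 1) (R' / 2 - R / 2 + R' / 64) ⊆ triAnnulusSet n R' :=
    fun v hv => by
      rw [mem_triStrip, e16, eD] at hv
      exact mem_triAnnulusSet_of_box (by omega) (by omega) (by omega) (by omega) (by omega)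
  have RB : triStrip ((R : ℤ) + (R / 8 : ℕ) + 1) (-((R / 2 : ℕ) : ℤ)) (R' - (R + R / 8 + 1)) (R' / 64) ⊆ triAnnulusSet n R' :=
    fun v hv => by
      rw [mem_triStrip, eB] at hv
      exact mem_triAnnulusSet_of_box (by omega) (by omega) (by omega) (by omega) (by omega)
  have RVh : triStrip ((R : ℤ) + (R / 8 : ℕ) + 1) (-(sepGlueHeight R : ℤ)) (R / 8) (sepGlueHeight R) ⊆ triAnnulusSet n R' :=
    fun v hv => by
      rw [mem_triStrip] at hv
      exact mem_triAnnulusSet_of_cols_rows_out (by omega) (by omega) hRR' (by omega) (by omega) (by omega) (by omega)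
  have RG : triStrip ((R : ℤ) + 1) (-(sepGlueHeight R : ℤ) + i * ((R / 64 / 2 : ℕ) : ℤ)) (2 * (R / 8)) (R / 64 / 2) ⊆
      triAnnulusSet n R' := fun v hv => by
    rw [sepOutComb_strip_iff] at hv
    exact mem_triAnnulusSet_of_cols_rows_out (by omega) (by omega) hRR' hv.1 hv.2.1 (by omega) (by omega)
  have hann : triAnnulusSet n R' ⊆ triAnnulusSet n R' ∪ triOpenBall z'' (R' / 8) := fun v hv => Or.inl hv
  set Reg := (triAnnulusSet n R' ∪ triOpenBall z'' (R' / 8)) ∩ ω with hReg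
  have P1 : PathIn triGraph Reg a₂ p₁ := Q1.mono fun v hv => ⟨R1 hv.1, hv.2⟩
  have PHd : PathIn triGraph Reg bd a₂ := by
    refine QH.symm.mono ?_
    rintro v ⟨hv | hv, hvω⟩
    exacts [⟨R1 hv, hvω⟩, ⟨hann (RD hv), hvω⟩]
  have P1b : PathIn triGraph Reg ab bd := by
    refine Q1b.mono ?_
    rintro v ⟨hv | hv, hvω⟩
    exacts [⟨hann (RB hv), hvω⟩, ⟨hann (RD hv), hvω⟩]
  have P2 : PathIn triGraph Reg bv ab := by
    refine Q2.symm.mono ?_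
    rintro v ⟨hv | hv, hvω⟩
    exacts [⟨hann (RB hv), hvω⟩, ⟨hann (RVh hv), hvω⟩]
  have P3 : PathIn triGraph Reg g₀ bv := by
    refine Q3.mono ?_
    rintro v ⟨hv | hv, hvω⟩
    exacts [⟨hann (RG hv), hvω⟩, ⟨hann (RVh hv), hvω⟩]
  have P4 : PathIn triGraph Reg b g₀ := by
    refine Q4.symm.mono ?_
    rintro v ⟨hv | hv, hvω⟩
    exacts [⟨hann (RG hv), hvω⟩, ⟨hann (R4 hv), hvω⟩]
  have P6 : PathIn triGraph Reg u' b := Pa.symm.mono fun v hv => ⟨hann (R4 hv.1), hv.2⟩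
  have P7 : PathIn triGraph Reg a u' := P.mono fun v hv => ⟨hann (R5 hv.1), hv.2⟩
  exact ⟨z'', p₁, a, mk_mem_sepLanding R', ha, hFence,
    ((((((P7.trans P6).trans P4).trans P3).trans P2).trans P1b).trans PHd).trans P1⟩

/-- **Outward extension of the four landed arms** along the bent corridor read in the four frames:
`extFourArmQ n R ∩ (C ∩ {frameConfig 2 ωᶜ ∈ C} ∩ {frameConfig 3 ω ∈ C} ∩ {frameConfig 5 ωᶜ ∈ C}) ⊆ extFourArmQ n R'`,
`C = sepOutCorrQ R R'`. [cite: Nolin2008, §4.3 Prop. 12 (i) (proof) (arXiv 0711.4948: Prop. 11)] -/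
theorem extFourArmQ_inter_corr_subset {n R R' : ℕ} (hR : 2200 ≤ R) (hnR : 2 * n ≤ R) (hRR' : 2 * R ≤ R') (hR'R : R' ≤ 32 * R) :
    extFourArmQ n R ∩ (sepOutCorrQ R R' ∩ {ω | frameConfig 3 ω ∈ sepOutCorrQ R R'} ∩
      ({ω | frameConfig 2 ωᶜ ∈ sepOutCorrQ R R'} ∩ {ω | frameConfig 5 ωᶜ ∈ sepOutCorrQ R R'})) ⊆ extFourArmQ n R' := by
  rintro ω ⟨⟨h0, h2, h3, h5⟩, ⟨g0, g3⟩, g2, g5⟩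
  exact ⟨extOpenArm_inter_sepOutCorrQ_subset hR hnR hRR' hR'R ⟨h0, g0⟩,
    extOpenArm_inter_sepOutCorrQ_subset hR hnR hRR' hR'R ⟨h2, g2⟩,
    extOpenArm_inter_sepOutCorrQ_subset hR hnR hRR' hR'R ⟨h3, g3⟩,
    extOpenArm_inter_sepOutCorrQ_subset hR hnR hRR' hR'R ⟨h5, g5⟩⟩

/-! ### Locality and probability of the corridor -/

/-- The sites of the boxes of the bent corridor. [folklore] -/
def sepOutCorrQFinset (R R' : ℕ) : Finset (Site 2) :=
  triStripFinset ((R' : ℤ) + 1) (-((R' / 2 : ℕ) : ℤ) - (R' / 64 : ℕ)) (R' / 16 - 1) (2 * (R' / 64)) ∪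
    triStripFinset ((R' : ℤ) - (R' / 16 : ℕ)) (-((R' / 2 : ℕ) : ℤ)) (2 * (R' / 16)) (R' / 64) ∪
    triStripFinset ((R' : ℤ) - (R' / 16 : ℕ)) (-((R' / 2 : ℕ) : ℤ)) (R' / 16 - 1) (R' / 2 - R / 2 + R' / 64) ∪
    triStripFinset ((R : ℤ) + (R / 8 : ℕ) + 1) (-((R / 2 : ℕ) : ℤ)) (R' - (R + R / 8 + 1)) (R' / 64) ∪
    triStripFinset ((R : ℤ) + (R / 8 : ℕ) + 1) (-(sepGlueHeight R : ℤ)) (R / 8) (sepGlueHeight R) ∪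
    (Finset.range 90).biUnion fun i =>
      triStripFinset ((R : ℤ) + 1) (-(sepGlueHeight R : ℤ) + i * ((R / 64 / 2 : ℕ) : ℤ)) (2 * (R / 8)) (R / 64 / 2)

/-- **The corridor lies in the cone of the right side beyond `Λ_R`**: its sites satisfy
`R < |v| ≤ R' + R'/8`, `x₁ ≤ 0 < x₀ + x₁` (`2200 ≤ R`, `2R ≤ R' ≤ 32 R`). [folklore] -/
theorem sepOutCorrQFinset_subset {R R' : ℕ} (hR : 2200 ≤ R) (hRR' : 2 * R ≤ R') (hR'R : R' ≤ 32 * R) {v : Site 2}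
    (hv : v ∈ sepOutCorrQFinset R R') :
    (R : ℤ) < triNorm v ∧ triNorm v ≤ (R' : ℤ) + (R' / 8 : ℕ) ∧ v 1 ≤ 0 ∧ 0 < v 0 + v 1 := by
  have hH := sepGlueHeight_cast R
  have hRR : 2 * (R : ℤ) ≤ R' := by exact_mod_cast hRR'
  have hR'R' : (R' : ℤ) ≤ 32 * R := by exact_mod_cast hR'R
  simp only [sepOutCorrQFinset, Finset.mem_union, Finset.mem_biUnion, Finset.mem_range] at hv
  rcases hv with ((((hv | hv) | hv) | hv) | hv) | ⟨i, hi, hv⟩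
  · rw [← Finset.mem_coe, coe_triStripFinset, mem_triStrip] at hv
    have e : ((R' / 16 - 1 : ℕ) : ℤ) = (R' / 16 : ℕ) - 1 := by omega
    rw [e] at hv
    simp only [Nat.cast_mul, Nat.cast_ofNat] at hv
    exact ⟨lt_triNorm_iff_lin.2 (Or.inl (by omega)), triNorm_le_iff_lin.2 (by omega), by omega, by omega⟩
  · rw [← Finset.mem_coe, coe_triStripFinset, mem_triStrip] at hv
    simp only [Nat.cast_mul, Nat.cast_ofNat] at hv
    exact ⟨lt_triNorm_iff_lin.2 (Or.inl (by omega)), triNorm_le_iff_lin.2 (by omega), by omega, by omega⟩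
  · rw [← Finset.mem_coe, coe_triStripFinset, mem_triStrip] at hv
    have e : ((R' / 16 - 1 : ℕ) : ℤ) = (R' / 16 : ℕ) - 1 := by omega
    have eD : ((R' / 2 - R / 2 + R' / 64 : ℕ) : ℤ) = (R' / 2 : ℕ) - (R / 2 : ℕ) + (R' / 64 : ℕ) := by omega
    rw [e, eD] at hv
    exact ⟨lt_triNorm_iff_lin.2 (Or.inl (by omega)), triNorm_le_iff_lin.2 (by omega), by omega, by omega⟩
  · rw [← Finset.mem_coe, coe_triStripFinset, mem_triStrip] at hv
    have eB : ((R' - (R + R / 8 + 1) : ℕ) : ℤ) = (R' : ℤ) - R - (R / 8 : ℕ) - 1 := by omega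
    rw [eB] at hv
    exact ⟨lt_triNorm_iff_lin.2 (Or.inl (by omega)), triNorm_le_iff_lin.2 (by omega), by omega, by omega⟩
  · rw [← Finset.mem_coe, coe_triStripFinset, mem_triStrip] at hv
    exact ⟨lt_triNorm_iff_lin.2 (Or.inl (by omega)), triNorm_le_iff_lin.2 (by omega), by omega, by omega⟩
  · rw [← Finset.mem_coe, coe_triStripFinset, sepOutComb_strip_iff] at hv
    have hih : (0 : ℤ) ≤ (i : ℤ) * ((R / 64 / 2 : ℕ) : ℤ) := by positivity
    have hih' : (i : ℤ) * ((R / 64 / 2 : ℕ) : ℤ) ≤ 89 * ((R / 64 / 2 : ℕ) : ℤ) :=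
      mul_le_mul_of_nonneg_right (by exact_mod_cast Nat.le_of_lt_succ hi) (by positivity)
    exact ⟨lt_triNorm_iff_lin.2 (Or.inl (by omega)), triNorm_le_iff_lin.2 (by omega), by omega, by omega⟩

/-- **Locality of the corridor.** [folklore] -/
theorem determinedBy_sepOutCorrQ (R R' : ℕ) : DeterminedBy (sepOutCorrQ R R') ↑(sepOutCorrQFinset R R') := by
  set F := sepOutCorrQFinset R R' with hF
  have c1 : (↑(triStripFinset ((R' : ℤ) + 1) (-((R' / 2 : ℕ) : ℤ) - (R' / 64 : ℕ)) (R' / 16 - 1) (2 * (R' / 64))) : Set (Site 2)) ⊆ ↑F :=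
    Finset.coe_subset.2 (Finset.subset_union_left.trans (Finset.subset_union_left.trans (Finset.subset_union_left.trans (Finset.subset_union_left.trans Finset.subset_union_left))))
  have c2 : (↑(triStripFinset ((R' : ℤ) - (R' / 16 : ℕ)) (-((R' / 2 : ℕ) : ℤ)) (2 * (R' / 16)) (R' / 64)) : Set (Site 2)) ⊆ ↑F :=
    Finset.coe_subset.2 (Finset.subset_union_right.trans (Finset.subset_union_left.trans (Finset.subset_union_left.trans (Finset.subset_union_left.trans Finset.subset_union_left))))
  have c3 : (↑(triStripFinset ((R' : ℤ) - (R' / 16 : ℕ)) (-((R' / 2 : ℕ) : ℤ)) (R' / 16 - 1) (R' / 2 - R / 2 + R' / 64)) : Set (Site 2)) ⊆ ↑F :=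
    Finset.coe_subset.2 (Finset.subset_union_right.trans (Finset.subset_union_left.trans (Finset.subset_union_left.trans Finset.subset_union_left)))
  have c4 : (↑(triStripFinset ((R : ℤ) + (R / 8 : ℕ) + 1) (-((R / 2 : ℕ) : ℤ)) (R' - (R + R / 8 + 1)) (R' / 64)) : Set (Site 2)) ⊆ ↑F :=
    Finset.coe_subset.2 (Finset.subset_union_right.trans (Finset.subset_union_left.trans Finset.subset_union_left))
  have c5 : (↑(triStripFinset ((R : ℤ) + (R / 8 : ℕ) + 1) (-(sepGlueHeight R : ℤ)) (R / 8) (sepGlueHeight R)) : Set (Site 2)) ⊆ ↑F :=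
    Finset.coe_subset.2 (Finset.subset_union_right.trans Finset.subset_union_left)
  have c6 : (↑((Finset.range 90).biUnion fun i : ℕ =>
      triStripFinset ((R : ℤ) + 1) (-(sepGlueHeight R : ℤ) + i * ((R / 64 / 2 : ℕ) : ℤ)) (2 * (R / 8)) (R / 64 / 2)) :
        Set (Site 2)) ⊆ ↑F :=
    Finset.coe_subset.2 (Finset.subset_union_right)
  refine ((((((determinedBy_triVCross _ _ _ _).mono c1).inter ((determinedBy_triHCross _ _ _ _).mono c2)).inter
    ((determinedBy_triVCross _ _ _ _).mono c3)).inter ((determinedBy_triHCross _ _ _ _).mono c4)).inter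
    ((determinedBy_triVCross _ _ _ _).mono c5)).inter ?_
  exact (DeterminedBy.biInter_finset (Finset.range 90) (E := fun i => sepOutComb R i)
    (F := fun i : ℕ => triStripFinset ((R : ℤ) + 1) (-(sepGlueHeight R : ℤ) + i * ((R / 64 / 2 : ℕ) : ℤ)) (2 * (R / 8)) (R / 64 / 2))
    fun i _ => determinedBy_triHCross _ _ _ _).mono c6

/-- **RSW and Harris for the bent corridor at `q`**: if `c ≤ P_q(long-way crossing of
`[0, ⌊ρ k⌋] × [0, k]`)` for `1 ≤ k ≤ Ncap` (`ρ ≥ 64`, `c ≥ 0`), then `P_q(sepOutCorrQ R R') ≥ c^95`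
for `2200 ≤ R`, `2R ≤ R' ≤ 32R`, `R' ≤ Ncap` (all `95` boxes have height `≤ R'` and aspect ratio `≤ 64`). [cite: Nolin2008, §4.3 Prop. 12 (proof) (arXiv 0711.4948: Prop. 11)] -/
theorem le_real_sepOutCorrQ_at (q : unitInterval) {c : ℝ} {ρ Ncap : ℕ}
    (hrsw : ∀ k : ℕ, 1 ≤ ⌊(ρ : ℝ) * k⌋₊ → k ≤ Ncap → c ≤ triLRCrossingProb q ⌊(ρ : ℝ) * k⌋₊ k)
    (hρ : 64 ≤ ρ) (hc : 0 ≤ c) {R R' : ℕ} (hR : 2200 ≤ R) (hRR' : 2 * R ≤ R') (hR'R : R' ≤ 32 * R) (hcap : R' ≤ Ncap) :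
    c ^ 95 ≤ (triSitePercolation q).real (sepOutCorrQ R R') := by
  classical
  have hfl : ∀ k : ℕ, ⌊(ρ : ℝ) * (k : ℕ)⌋₊ = ρ * k := fun k => by
    have : (ρ : ℝ) * (k : ℕ) = ((ρ * k : ℕ) : ℝ) := by push_cast; ring
    rw [this, Nat.floor_natCast]
  have hcw : ∀ L k : ℕ, 1 ≤ k → k ≤ Ncap → L ≤ 64 * k → c ≤ triLRCrossingProb q L k := fun L k hk hkc hL => by
    have h := hrsw k (by rw [hfl]; nlinarith) hkc
    rw [hfl] at h
    exact h.trans (triLRCrossingProb_anti_width q (by nlinarith) k)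
  set E1 := triVCross ((R' : ℤ) + 1) (-((R' / 2 : ℕ) : ℤ) - (R' / 64 : ℕ)) (R' / 16 - 1) (2 * (R' / 64)) with hE1
  set E2 := triHCross ((R' : ℤ) - (R' / 16 : ℕ)) (-((R' / 2 : ℕ) : ℤ)) (2 * (R' / 16)) (R' / 64) with hE2
  set E3 := triVCross ((R' : ℤ) - (R' / 16 : ℕ)) (-((R' / 2 : ℕ) : ℤ)) (R' / 16 - 1) (R' / 2 - R / 2 + R' / 64) with hE3
  set E4 := triHCross ((R : ℤ) + (R / 8 : ℕ) + 1) (-((R / 2 : ℕ) : ℤ)) (R' - (R + R / 8 + 1)) (R' / 64) with hE4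
  set E5 := triVCross ((R : ℤ) + (R / 8 : ℕ) + 1) (-(sepGlueHeight R : ℤ)) (R / 8) (sepGlueHeight R) with hE5
  set G := ⋂ i ∈ Finset.range 90, sepOutComb R i with hG
  set F := sepOutCorrQFinset R R' with hF
  have c1 : (↑(triStripFinset ((R' : ℤ) + 1) (-((R' / 2 : ℕ) : ℤ) - (R' / 64 : ℕ)) (R' / 16 - 1) (2 * (R' / 64))) : Set (Site 2)) ⊆ ↑F :=
    Finset.coe_subset.2 (Finset.subset_union_left.trans (Finset.subset_union_left.trans (Finset.subset_union_left.trans (Finset.subset_union_left.trans Finset.subset_union_left))))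
  have c2 : (↑(triStripFinset ((R' : ℤ) - (R' / 16 : ℕ)) (-((R' / 2 : ℕ) : ℤ)) (2 * (R' / 16)) (R' / 64)) : Set (Site 2)) ⊆ ↑F :=
    Finset.coe_subset.2 (Finset.subset_union_right.trans (Finset.subset_union_left.trans (Finset.subset_union_left.trans (Finset.subset_union_left.trans Finset.subset_union_left))))
  have c3 : (↑(triStripFinset ((R' : ℤ) - (R' / 16 : ℕ)) (-((R' / 2 : ℕ) : ℤ)) (R' / 16 - 1) (R' / 2 - R / 2 + R' / 64)) : Set (Site 2)) ⊆ ↑F :=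
    Finset.coe_subset.2 (Finset.subset_union_right.trans (Finset.subset_union_left.trans (Finset.subset_union_left.trans Finset.subset_union_left)))
  have c4 : (↑(triStripFinset ((R : ℤ) + (R / 8 : ℕ) + 1) (-((R / 2 : ℕ) : ℤ)) (R' - (R + R / 8 + 1)) (R' / 64)) : Set (Site 2)) ⊆ ↑F :=
    Finset.coe_subset.2 (Finset.subset_union_right.trans (Finset.subset_union_left.trans Finset.subset_union_left))
  have c5 : (↑(triStripFinset ((R : ℤ) + (R / 8 : ℕ) + 1) (-(sepGlueHeight R : ℤ)) (R / 8) (sepGlueHeight R)) : Set (Site 2)) ⊆ ↑F :=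
    Finset.coe_subset.2 (Finset.subset_union_right.trans Finset.subset_union_left)
  have c6 : (↑((Finset.range 90).biUnion fun i : ℕ =>
      triStripFinset ((R : ℤ) + 1) (-(sepGlueHeight R : ℤ) + i * ((R / 64 / 2 : ℕ) : ℤ)) (2 * (R / 8)) (R / 64 / 2)) :
        Set (Site 2)) ⊆ ↑F :=
    Finset.coe_subset.2 (Finset.subset_union_right)
  have d1 : DeterminedBy E1 ↑F := (determinedBy_triVCross _ _ _ _).mono c1
  have d2 : DeterminedBy E2 ↑F := (determinedBy_triHCross _ _ _ _).mono c2
  have d3 : DeterminedBy E3 ↑F := (determinedBy_triVCross _ _ _ _).mono c3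
  have d4 : DeterminedBy E4 ↑F := (determinedBy_triHCross _ _ _ _).mono c4
  have d5 : DeterminedBy E5 ↑F := (determinedBy_triVCross _ _ _ _).mono c5
  have dG : DeterminedBy G ↑F := (DeterminedBy.biInter_finset (Finset.range 90) (E := fun i => sepOutComb R i)
    (F := fun i : ℕ => triStripFinset ((R : ℤ) + 1) (-(sepGlueHeight R : ℤ) + i * ((R / 64 / 2 : ℕ) : ℤ)) (2 * (R / 8)) (R / 64 / 2))
    fun i _ => determinedBy_triHCross _ _ _ _).mono c6
  have u1 : IsUpperSet E1 := isUpperSet_triVCross _ _ _ _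
  have u2 : IsUpperSet E2 := isUpperSet_triHCross _ _ _ _
  have u3 : IsUpperSet E3 := isUpperSet_triVCross _ _ _ _
  have u4 : IsUpperSet E4 := isUpperSet_triHCross _ _ _ _
  have u5 : IsUpperSet E5 := isUpperSet_triVCross _ _ _ _
  have uG : IsUpperSet G := isUpperSet_iInter₂ fun i _ => isUpperSet_triHCross _ _ _ _
  have hGH : sepGlueHeight R = R - R / 4 + R / 64 := rfl
  have e1 : c ≤ (triSitePercolation q).real E1 := by
    rw [hE1, triSitePercolation_real_triVCross]; exact hcw _ _ (by omega) (by omega) (by omega)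
  have e2 : c ≤ (triSitePercolation q).real E2 := by
    rw [hE2, triSitePercolation_real_triHCross]; exact hcw _ _ (by omega) (by omega) (by omega)
  have e3 : c ≤ (triSitePercolation q).real E3 := by
    rw [hE3, triSitePercolation_real_triVCross]; exact hcw _ _ (by omega) (by omega) (by omega)
  have e4 : c ≤ (triSitePercolation q).real E4 := by
    rw [hE4, triSitePercolation_real_triHCross]; exact hcw _ _ (by omega) (by omega) (by omega)
  have e5 : c ≤ (triSitePercolation q).real E5 := by
    rw [hE5, triSitePercolation_real_triVCross]; exact hcw _ _ (by omega) (by omega) (by rw [hGH]; omega)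
  have eG : c ^ 90 ≤ (triSitePercolation q).real G := by
    have hprod := sitePercolation_real_biInter_ge_prod q (Finset.range 90) (E := fun i => sepOutComb R i)
      (F := fun i => triStripFinset ((R : ℤ) + 1) (-(sepGlueHeight R : ℤ) + i * ((R / 64 / 2 : ℕ) : ℤ)) (2 * (R / 8)) (R / 64 / 2))
      (fun i _ => determinedBy_triHCross _ _ _ _) (fun i _ => isUpperSet_triHCross _ _ _ _)
    have heach : ∀ i ∈ Finset.range 90, c ≤ (sitePercolation (Site 2) q).real (sepOutComb R i) := fun i _ => by
      have := triSitePercolation_real_triHCross q ((R : ℤ) + 1)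
        (-(sepGlueHeight R : ℤ) + i * ((R / 64 / 2 : ℕ) : ℤ)) (2 * (R / 8)) (R / 64 / 2)
      unfold triSitePercolation at this
      rw [sepOutComb, this]
      exact hcw _ _ (by omega) (by omega) (by omega)
    have hle : c ^ 90 ≤ ∏ i ∈ Finset.range 90, (sitePercolation (Site 2) q).real (sepOutComb R i) := by
      calc c ^ 90 = ∏ _i ∈ Finset.range 90, c := by rw [Finset.prod_const, Finset.card_range]
        _ ≤ _ := Finset.prod_le_prod (fun _ _ => hc) heach
    unfold triSitePercolation
    exact hle.trans hprod
  have h12 := sitePercolation_harris q d1 d2 u1 u2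
  have h123 := sitePercolation_harris q (d1.inter d2) d3 (u1.inter u2) u3
  have h1234 := sitePercolation_harris q ((d1.inter d2).inter d3) d4 ((u1.inter u2).inter u3) u4
  have h12345 := sitePercolation_harris q (((d1.inter d2).inter d3).inter d4) d5 (((u1.inter u2).inter u3).inter u4) u5
  have h123456 := sitePercolation_harris q ((((d1.inter d2).inter d3).inter d4).inter d5) dG
    ((((u1.inter u2).inter u3).inter u4).inter u5) uG
  have hdef : sepOutCorrQ R R' = E1 ∩ E2 ∩ E3 ∩ E4 ∩ E5 ∩ G := rfl
  unfold triSitePercolation at e1 e2 e3 e4 e5 eG ⊢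
  rw [hdef]
  set μ := sitePercolation (Site 2) q with hμ
  have h0 : ∀ s, 0 ≤ μ.real s := fun s => measureReal_nonneg
  calc c ^ 95 = c * c * c * c * c * c ^ 90 := by ring
    _ ≤ μ.real E1 * μ.real E2 * μ.real E3 * μ.real E4 * μ.real E5 * μ.real G := by
        have t2 := mul_le_mul e1 e2 hc (h0 _)
        have t3 := mul_le_mul t2 e3 hc (mul_nonneg (h0 _) (h0 _))
        have t4 := mul_le_mul t3 e4 hc (mul_nonneg (mul_nonneg (h0 _) (h0 _)) (h0 _))
        have t5 := mul_le_mul t4 e5 hc (mul_nonneg (mul_nonneg (mul_nonneg (h0 _) (h0 _)) (h0 _)) (h0 _))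
        exact mul_le_mul t5 eG (pow_nonneg hc _) (mul_nonneg (mul_nonneg (mul_nonneg (mul_nonneg (h0 _) (h0 _)) (h0 _)) (h0 _)) (h0 _))
    _ ≤ μ.real (E1 ∩ E2) * μ.real E3 * μ.real E4 * μ.real E5 * μ.real G :=
        mul_le_mul_of_nonneg_right (mul_le_mul_of_nonneg_right (mul_le_mul_of_nonneg_right
          (mul_le_mul_of_nonneg_right h12 (h0 _)) (h0 _)) (h0 _)) (h0 _)
    _ ≤ μ.real (E1 ∩ E2 ∩ E3) * μ.real E4 * μ.real E5 * μ.real G :=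
        mul_le_mul_of_nonneg_right (mul_le_mul_of_nonneg_right (mul_le_mul_of_nonneg_right h123 (h0 _)) (h0 _)) (h0 _)
    _ ≤ μ.real (E1 ∩ E2 ∩ E3 ∩ E4) * μ.real E5 * μ.real G :=
        mul_le_mul_of_nonneg_right (mul_le_mul_of_nonneg_right h1234 (h0 _)) (h0 _)
    _ ≤ μ.real (E1 ∩ E2 ∩ E3 ∩ E4 ∩ E5) * μ.real G := mul_le_mul_of_nonneg_right h12345 (h0 _)
    _ ≤ μ.real (E1 ∩ E2 ∩ E3 ∩ E4 ∩ E5 ∩ G) := h123456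

/-! ### The extension inequality -/

/-- Framing the corridor in the frame `i`: determined by the image of its sites, increasing. [folklore] -/
theorem determinedBy_frame_sepOutCorrQ (i R R' : ℕ) :
    DeterminedBy {ω : SiteConfig (Site 2) | frameConfig i ω ∈ sepOutCorrQ R R'} (frameIso i '' ↑(sepOutCorrQFinset R R')) ∧
      DeterminedBy {ω : SiteConfig (Site 2) | frameConfig i ωᶜ ∈ sepOutCorrQ R R'} (frameIso i '' ↑(sepOutCorrQFinset R R')) := by
  have hE := determinedBy_preimage_frameConfig i (determinedBy_sepOutCorrQ R R')
  refine ⟨hE, ?_⟩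
  have h2 : {ω : SiteConfig (Site 2) | frameConfig i ωᶜ ∈ sepOutCorrQ R R'} =
      {ω : SiteConfig (Site 2) | ωᶜ ∈ {χ : SiteConfig (Site 2) | frameConfig i χ ∈ sepOutCorrQ R R'}} := by
    ext ω; simp only [Set.mem_setOf_eq]
  rw [h2]
  exact DeterminedBy.preimage_compl' hE

/-- **Outward extension of the four landed arms at constant cost, at `p`** (Nolin 2008, Prop. 12 (i)
on the external boundary via Lemma 13; §4.4 p. 12, the constant `C₀`): with the RSW input `hrsw`
at `p` and at `1 - p` (aspect ratio `ρ ≥ 64`, heights `≤ Ncap`), for `2200 ≤ R`, `2n ≤ R`,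
`2R ≤ R' ≤ 32R`, `R' ≤ Ncap`:
`P_p(extFourArmQ n R) · (c^95)⁴ ≤ P_p(extFourArmQ n R')`. The generalised FKG inequality
`triSitePercolation_locallyMonotone_fkg` with the shared shell `{n ≤ |v| ≤ R}`, the increasing
region `{R < |v|} ∩ (cone 0 ∪ cone 3)` (the open arms' free spaces and bent corridors) and the
decreasing region `{R < |v|} ∩ (cone 2 ∪ cone 5)` (the closed arms'), Harris at `p` for the two
open corridors and at `1 - p` for the two closed ones, and the deterministic gluing. [cite: Nolin2008, §4.3 Prop. 12 (i) and Lemma 13 (arXiv 0711.4948: Prop. 11, Lemma 12); §4.4 p. 12] -/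
theorem real_extFourArmQ_mul_le_outward_at (p : unitInterval) {c : ℝ} {ρ Ncap : ℕ}
    (hrsw : ∀ q : unitInterval, (q = p ∨ q = unitInterval.symm p) →
      ∀ k : ℕ, 1 ≤ ⌊(ρ : ℝ) * k⌋₊ → k ≤ Ncap → c ≤ triLRCrossingProb q ⌊(ρ : ℝ) * k⌋₊ k)
    (hρ : 64 ≤ ρ) (hc : 0 ≤ c) {n R R' : ℕ} (hR : 2200 ≤ R) (hnR : 2 * n ≤ R) (hRR' : 2 * R ≤ R') (hR'R : R' ≤ 32 * R)
    (hcap : R' ≤ Ncap) :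
    (triSitePercolation p).real (extFourArmQ n R) * (c ^ 95) ^ 4 ≤ (triSitePercolation p).real (extFourArmQ n R') := by
  classical
  set C := sepOutCorrQ R R' with hC
  -- the three pairwise disjoint regions of Nolin's Lemma 13
  set S : Finset (Site 2) := (triBall R).filter (fun v => (n : ℤ) ≤ triNorm v) with hS
  set P : Finset (Site 2) := (triBall (R' + R' / 8)).filter
    (fun v => (R : ℤ) < triNorm v ∧ ((v 1 ≤ 0 ∧ 0 < v 0 + v 1) ∨ (0 ≤ v 1 ∧ v 0 + v 1 < 0))) with hP
  set M : Finset (Site 2) := (triBall (R' + R' / 8)).filter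
    (fun v => (R : ℤ) < triNorm v ∧ ((v 0 ≤ 0 ∧ 0 < v 0 + v 1) ∨ (0 ≤ v 0 ∧ v 0 + v 1 < 0))) with hM
  have hSP : Disjoint S P := by
    rw [Finset.disjoint_left]; intro v hvS hvP
    simp only [hS, hP, Finset.mem_filter, mem_triBall_iff] at hvS hvP
    omega
  have hSM : Disjoint S M := by
    rw [Finset.disjoint_left]; intro v hvS hvM
    simp only [hS, hM, Finset.mem_filter, mem_triBall_iff] at hvS hvM
    omega
  have hPM : Disjoint P M := by
    rw [Finset.disjoint_left]; intro v hvP hvM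
    simp only [hP, hM, Finset.mem_filter] at hvP hvM
    omega
  have hRR : 2 * (R : ℤ) ≤ R' := by exact_mod_cast hRR'
  have h88 : (R : ℤ) + (R / 8 : ℕ) ≤ (R' : ℤ) + (R' / 8 : ℕ) := by omega
  -- supports of the arms
  have coneSup : ∀ (i : ℕ) (hi : i < 6), (i = 0 ∨ i = 3 → frameIso i '' extConeSet n R ⊆ ↑S ∪ ↑P) ∧
      (i = 2 ∨ i = 5 → frameIso i '' extConeSet n R ⊆ ↑S ∪ ↑M) := by
    intro i hi
    constructor
    · rintro hi0 v ⟨u, hu, rfl⟩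
      rw [mem_extConeSet] at hu
      obtain ⟨f00, f01, -, -, -, -, f30, f31, -⟩ := frameIso_apply_formula u
      simp only [hS, hP, Set.mem_union, Finset.mem_coe, Finset.mem_filter, mem_triBall_iff, triNorm_frameIso i hi]
      push_cast at hu ⊢
      by_cases h : triNorm u ≤ (R : ℤ)
      · left; exact ⟨h, hu.1⟩
      · right
        refine ⟨by omega, by omega, ?_⟩
        have hc := hu.2.2 (by omega)
        rcases hi0 with rfl | rfl
        · left; rw [f00, f01]; omega
        · right; rw [f30, f31]; omega
    · rintro hi2 v ⟨u, hu, rfl⟩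
      rw [mem_extConeSet] at hu
      obtain ⟨-, -, -, -, f20, f21, -, -, -, -, f50, f51⟩ := frameIso_apply_formula u
      simp only [hS, hM, Set.mem_union, Finset.mem_coe, Finset.mem_filter, mem_triBall_iff, triNorm_frameIso i hi]
      push_cast at hu ⊢
      by_cases h : triNorm u ≤ (R : ℤ)
      · left; exact ⟨h, hu.1⟩
      · right
        refine ⟨by omega, by omega, ?_⟩
        have hc := hu.2.2 (by omega)
        rcases hi2 with rfl | rfl
        · left; rw [f20, f21]; omega
        · right; rw [f50, f51]; omega
  -- supports of the corridors
  have corrSup : ∀ (i : ℕ) (hi : i < 6), (i = 0 ∨ i = 3 → frameIso i '' ↑(sepOutCorrQFinset R R') ⊆ ↑P) ∧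
      (i = 2 ∨ i = 5 → frameIso i '' ↑(sepOutCorrQFinset R R') ⊆ ↑M) := by
    intro i hi
    constructor
    · rintro hi0 v ⟨u, hu, rfl⟩
      have h := sepOutCorrQFinset_subset hR hRR' hR'R (Finset.mem_coe.1 hu)
      obtain ⟨f00, f01, -, -, -, -, f30, f31, -⟩ := frameIso_apply_formula u
      simp only [hP, Finset.mem_coe, Finset.mem_filter, mem_triBall_iff, triNorm_frameIso i hi]
      push_cast
      refine ⟨h.2.1, h.1, ?_⟩
      rcases hi0 with rfl | rfl
      · left; rw [f00, f01]; omega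
      · right; rw [f30, f31]; omega
    · rintro hi2 v ⟨u, hu, rfl⟩
      have h := sepOutCorrQFinset_subset hR hRR' hR'R (Finset.mem_coe.1 hu)
      obtain ⟨-, -, -, -, f20, f21, -, -, -, -, f50, f51⟩ := frameIso_apply_formula u
      simp only [hM, Finset.mem_coe, Finset.mem_filter, mem_triBall_iff, triNorm_frameIso i hi]
      push_cast
      refine ⟨h.2.1, h.1, ?_⟩
      rcases hi2 with rfl | rfl
      · left; rw [f20, f21]; omega
      · right; rw [f50, f51]; omega
  -- the events
  set E := extOpenArm n R with hE
  set Ap : Set (SiteConfig (Site 2)) := E ∩ {ω | frameConfig 3 ω ∈ E} with hAp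
  set Am : Set (SiteConfig (Site 2)) := {ω | frameConfig 2 ωᶜ ∈ E} ∩ {ω | frameConfig 5 ωᶜ ∈ E} with hAm
  set Bp : Set (SiteConfig (Site 2)) := C ∩ {ω | frameConfig 3 ω ∈ C} with hBp
  set Bm : Set (SiteConfig (Site 2)) := {ω | frameConfig 2 ωᶜ ∈ C} ∩ {ω | frameConfig 5 ωᶜ ∈ C} with hBm
  have huE := isUpperSet_extOpenArm n R
  have huC := isUpperSet_sepOutCorrQ R R'
  have upre : ∀ {F : Set (SiteConfig (Site 2))}, IsUpperSet F → ∀ i, IsUpperSet {ω : SiteConfig (Site 2) | frameConfig i ω ∈ F} :=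
    fun hF i ω ω' h hω => hF (frameConfig_mono i h) hω
  have lpre : ∀ {F : Set (SiteConfig (Site 2))}, IsUpperSet F → ∀ i, IsLowerSet {ω : SiteConfig (Site 2) | frameConfig i ωᶜ ∈ F} :=
    fun hF i ω ω' h hω => hF (frameConfig_mono i (Set.compl_subset_compl.2 h)) hω
  have hAp_up : IsUpperSet Ap := huE.inter (upre huE 3)
  have hAm_lo : IsLowerSet Am := (lpre huE 2).inter (lpre huE 5)
  have hBp_up : IsUpperSet Bp := huC.inter (upre huC 3)
  have hBm_lo : IsLowerSet Bm := (lpre huC 2).inter (lpre huC 5)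
  -- locality
  have dE := determinedBy_extOpenArm_cone (n := n) (N := R) hnR
  have dEf := fun i => determinedBy_preimage_frameConfig i dE
  have dEfc : ∀ i, DeterminedBy {ω : SiteConfig (Site 2) | frameConfig i ωᶜ ∈ E} (frameIso i '' extConeSet n R) := fun i => by
    have h2 : {ω : SiteConfig (Site 2) | frameConfig i ωᶜ ∈ E} =
        {ω : SiteConfig (Site 2) | ωᶜ ∈ {χ : SiteConfig (Site 2) | frameConfig i χ ∈ E}} := by
      ext ω; simp only [Set.mem_setOf_eq]
    rw [h2]; exact DeterminedBy.preimage_compl' (dEf i)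
  have hE0 : {ω : SiteConfig (Site 2) | frameConfig 0 ω ∈ E} = E := by
    ext ω; simp only [Set.mem_setOf_eq]
    have : frameConfig 0 ω = ω := by ext v; rw [mem_frameConfig]; rfl
    rw [this]
  have dAp : DeterminedBy Ap (↑S ∪ ↑P) := by
    refine DeterminedBy.inter ?_ ((dEf 3).mono ((coneSup 3 (by norm_num)).1 (Or.inr rfl)))
    have := (dEf 0).mono ((coneSup 0 (by norm_num)).1 (Or.inl rfl))
    rwa [hE0] at this
  have dAm : DeterminedBy Am (↑S ∪ ↑M) :=
    ((dEfc 2).mono ((coneSup 2 (by norm_num)).2 (Or.inl rfl))).inter ((dEfc 5).mono ((coneSup 5 (by norm_num)).2 (Or.inr rfl)))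
  have dC := determinedBy_sepOutCorrQ R R'
  have dCf := fun i => determinedBy_frame_sepOutCorrQ i R R'
  have hC0 : {ω : SiteConfig (Site 2) | frameConfig 0 ω ∈ C} = C := by
    ext ω; simp only [Set.mem_setOf_eq]
    have : frameConfig 0 ω = ω := by ext v; rw [mem_frameConfig]; rfl
    rw [this]
  have dBp : DeterminedBy Bp ↑P := by
    refine DeterminedBy.inter ?_ ((dCf 3).1.mono ((corrSup 3 (by norm_num)).1 (Or.inr rfl)))
    have := (dCf 0).1.mono ((corrSup 0 (by norm_num)).1 (Or.inl rfl))
    rwa [hC0] at this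
  have dBm : DeterminedBy Bm ↑M :=
    ((dCf 2).2.mono ((corrSup 2 (by norm_num)).2 (Or.inl rfl))).inter ((dCf 5).2.mono ((corrSup 5 (by norm_num)).2 (Or.inr rfl)))
  have fkg := triSitePercolation_locallyMonotone_fkg p hSP hSM hPM hAp_up hAm_lo hBp_up hBm_lo dAp dAm dBp dBm
  -- the corridor probabilities
  have hcorr : ∀ q : unitInterval, (q = p ∨ q = unitInterval.symm p) → c ^ 95 ≤ (triSitePercolation q).real C :=
    fun q hq => le_real_sepOutCorrQ_at q (hrsw q hq) hρ hc hR hRR' hR'R hcap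
  set F := sepOutCorrQFinset R R' with hF
  have hBp_ge : (c ^ 95) ^ 2 ≤ (triSitePercolation p).real Bp := by
    have h3 : (triSitePercolation p).real {ω : SiteConfig (Site 2) | frameConfig 3 ω ∈ C} = (triSitePercolation p).real C :=
      real_preimage_frameConfig p 3 C
    have dC' : DeterminedBy C ↑F := dC
    have d3' : DeterminedBy {ω : SiteConfig (Site 2) | frameConfig 3 ω ∈ C} ↑(F.image (frameIso 3)) := by
      rw [Finset.coe_image]; exact (dCf 3).1
    have har := sitePercolation_harris' p dC' d3' huC (upre huC 3)
    unfold triSitePercolation at h3 hcorr ⊢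
    rw [h3] at har
    have h1 := hcorr p (Or.inl rfl)
    calc (c ^ 95) ^ 2 = c ^ 95 * c ^ 95 := sq _
      _ ≤ (sitePercolation (Site 2) p).real C * (sitePercolation (Site 2) p).real C :=
          mul_le_mul h1 h1 (pow_nonneg hc _) measureReal_nonneg
      _ ≤ _ := har
  have hBm_ge : (c ^ 95) ^ 2 ≤ (triSitePercolation p).real Bm := by
    set q := unitInterval.symm p with hq
    have heq : Bm = compl ⁻¹' ({χ : SiteConfig (Site 2) | frameConfig 2 χ ∈ C} ∩ {χ | frameConfig 5 χ ∈ C}) := by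
      ext ω; simp only [hBm, Set.mem_inter_iff, Set.mem_setOf_eq, Set.mem_preimage]
    have hcmp := sitePercolation_real_preimage_compl p ({χ : SiteConfig (Site 2) | frameConfig 2 χ ∈ C} ∩ {χ | frameConfig 5 χ ∈ C})
    have h2 : (triSitePercolation q).real {ω : SiteConfig (Site 2) | frameConfig 2 ω ∈ C} = (triSitePercolation q).real C :=
      real_preimage_frameConfig q 2 C
    have h5 : (triSitePercolation q).real {ω : SiteConfig (Site 2) | frameConfig 5 ω ∈ C} = (triSitePercolation q).real C :=
      real_preimage_frameConfig q 5 C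
    have d2' : DeterminedBy {ω : SiteConfig (Site 2) | frameConfig 2 ω ∈ C} ↑(F.image (frameIso 2)) := by
      rw [Finset.coe_image]; exact (dCf 2).1
    have d5' : DeterminedBy {ω : SiteConfig (Site 2) | frameConfig 5 ω ∈ C} ↑(F.image (frameIso 5)) := by
      rw [Finset.coe_image]; exact (dCf 5).1
    have har := sitePercolation_harris' q d2' d5' (upre huC 2) (upre huC 5)
    unfold triSitePercolation at h2 h5 hcorr hcmp ⊢
    rw [h2, h5] at har
    rw [heq, hcmp]
    have h1 := hcorr q (Or.inr rfl)
    calc (c ^ 95) ^ 2 = c ^ 95 * c ^ 95 := sq _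
      _ ≤ (sitePercolation (Site 2) q).real C * (sitePercolation (Site 2) q).real C :=
          mul_le_mul h1 h1 (pow_nonneg hc _) measureReal_nonneg
      _ ≤ _ := har
  -- assemble
  have hAA : extFourArmQ n R = Ap ∩ Am := by
    ext ω; simp only [extFourArmQ, hAp, hAm, hE, Set.mem_setOf_eq, Set.mem_inter_iff]; tauto
  have hsub := extFourArmQ_inter_corr_subset (n := n) hR hnR hRR' hR'R
  have h0 : 0 ≤ (triSitePercolation p).real (extFourArmQ n R) := measureReal_nonneg
  calc (triSitePercolation p).real (extFourArmQ n R) * (c ^ 95) ^ 4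
      = (triSitePercolation p).real (extFourArmQ n R) * ((c ^ 95) ^ 2 * (c ^ 95) ^ 2) := by ring
    _ ≤ (triSitePercolation p).real (Ap ∩ Am) * ((triSitePercolation p).real Bp * (triSitePercolation p).real Bm) := by
        rw [hAA]
        exact mul_le_mul_of_nonneg_left (mul_le_mul hBp_ge hBm_ge (by positivity) measureReal_nonneg) (by rw [← hAA]; exact h0)
    _ ≤ (triSitePercolation p).real (Ap ∩ Am ∩ (Bp ∩ Bm)) := fkg
    _ ≤ (triSitePercolation p).real (extFourArmQ n R') := by
        refine measureReal_mono ?_ (measure_ne_top _ _)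
        rw [← hAA]
        intro ω hω
        exact hsub ⟨hω.1, hω.2.1, hω.2.2⟩

end Literature.Probability.Percolation
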